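import Summits.QuantumFields.YangMills.Theorems.AtomicCalibrationRLevelWeights

/-!
# Leaf `HypercubicOSDataFromInfiniteVolume` (stmt-QuantumFields-19868), LINES «TemperedPeak» / «OctaveDoubling», stub W `stub_weightedWhitneyPkg` —
# the WEIGHTED Whitney weights of every level (twin of `AtomicCalibrationR.LevelWeights.level_weights` with the extra weight `ρ_k^{−K₀ n}`)

Construction (T) of the landed E2 package (`LevelWeights.level_weights`: pieces `P_{k,c} = G · tele(pairCut n ·) k · gridBump φ n h_k c`, mesh
`h_k = 2^{−k}/(8(Λ+1))`, radius `ρ_k = 2h_k`) with ONE change: at the band levels `k+1` the flatness order fed to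
`GevreyLevelMass.level_mass_factorial` is `K = N'n + 4n + 2 + K₀·n` instead of `N'n + 4n + 2`, so that the dyadic gain `(2^{−k})^{K}` also pays the
weight `ρ_{k+1}^{−K₀ n} = (8(Λ+1)·2^{k})^{K₀ n}`; the far level is unchanged (`ρ₀ = 1/(4(Λ+1))` is a constant).  Result:

* `level_weights_weighted` — there are `α, C, γ` (depending only on `Λ, N', K₀, s` and the Gevrey constants) such that for every `n ≥ 1`, every
  off-diagonal `F`, every dominated real `C^∞` factor `G` and EVERY level `k` there are weights `M ≥ 0` on the cubes with `Summable M`,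
  `Σ' M ≤ α Cⁿ (n!)^γ 2^{−k} ‖F‖_{(N'+6+K₀)n}`, **`Σ' M / ρ_k^{K₀ n} ≤ α Cⁿ (n!)^γ 2^{−k} ‖F‖_{(N'+6+K₀)n}`** and `‖D^m P_{k,c}(z)‖ ≤ M c / ρ_k^m` for all
  `m ≤ N'n` (the constant is the E2 constant with `C ↦ C·(16(Λ+1))^{K₀}`).

Pure real analysis; no definitions; nothing here touches Yang–Mills; no stub/crux/rung/summit is closed by this file; the YM mass gap is NOT proved.
[folklore]
-/

set_option autoImplicit false

noncomputable section

open scoped BigOperators ContDiff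
open Set
open Summit.QuantumFields.YangMills.Cruxes.AtomicCalibrationR.PairCutoff (pairCut stepψ contDiff_stepψ stepψ_eq_one stepψ_nonneg
  stepψ_le_one)
open Summit.QuantumFields.YangMills.Cruxes.AtomicCalibrationR.GridPartition (gridBump gridCentre profile_sub_eq_zero
  sum_Icc_profile_eq_one)
open Summit.QuantumFields.YangMills.Cruxes.AtomicCalibrationR.TelescopingAssembly (tele)
open Summit.QuantumFields.YangMills.Cruxes.AtomicCalibrationR.GevreyBandBump (cut norm_iteratedFDeriv_bandBump_le_gevrey
  norm_iteratedFDeriv_farBump_le_gevrey)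
open Summit.QuantumFields.YangMills.Cruxes.AtomicCalibrationR.MassInputs (bandPiece_eq_zero_of_lt_two)
open Summit.QuantumFields.YangMills.Cruxes.AtomicCalibrationR.GevreyLevelMass (level_mass_factorial)
open Summit.QuantumFields.YangMills.Cruxes.AtomicCalibrationR.GevreyFarLevelMass (far_level_mass_factorial)
open Summit.QuantumFields.YangMills.Cruxes.AtomicCalibrationR.LevelConstants
open Summit.QuantumFields.YangMills.Cruxes.AtomicCalibrationR.LevelWeights (cut_stepψ tele_pairCut_zero tele_pairCut_succ far_skeleton
  band_skeleton)
open Literature.MathematicalPhysics.QuantumLattice (schwartzNorm schwartzNorm_nonneg schwartzNorm_mono)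
open Literature.MathematicalPhysics.AQFT (IsOffDiagonal)

namespace Summit.QuantumFields.YangMills.Cruxes.HypercubicOSDataFromInfiniteVolume.WeightedWhitney

variable {n : ℕ}

/-- The radius identity of the band levels: `2h_{k+1} · (8(Λ+1)) = 2^{−k}`. -/
theorem two_mesh_succ_mul {Λ : ℝ} (hΛ : 1 ≤ Λ) (k : ℕ) :
    2 * ((2 : ℝ)⁻¹ ^ (k + 1) / (8 * (Λ + 1))) * (8 * (Λ + 1)) = (2 : ℝ)⁻¹ ^ k := by
  have hL : (0 : ℝ) < Λ + 1 := by linarith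
  field_simp
  rw [pow_succ]
  ring

/-- The radius identity of the far level: `2h₀ · (4(Λ+1)) = 1`. -/
theorem two_mesh_zero_mul {Λ : ℝ} (hΛ : 1 ≤ Λ) :
    2 * ((2 : ℝ)⁻¹ ^ 0 / (8 * (Λ + 1))) * (4 * (Λ + 1)) = 1 := by
  have hL : (0 : ℝ) < Λ + 1 := by linarith
  rw [pow_zero]; field_simp; ring

/-- **The WEIGHTED Whitney weights of every level** (clauses (v)–(vi) of `WhitneyPkgW`, per level, uniformly in the level): see the module
docstring. [folklore] -/
theorem level_weights_weighted {Λ : ℝ} (hΛ : 1 ≤ Λ) (N' K₀ s : ℕ)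
    {φ : ℝ → ℝ} (hφ : ContDiff ℝ ∞ φ) (hφs : tsupport φ ⊆ Icc (-1 : ℝ) 1) (hφ0 : ∀ t, 0 ≤ φ t)
    (hφ1 : ∀ t, ∑' c : ℤ, φ (t - c) = 1) {C₀ C₁ C₀' C₁' : ℝ} (hC₀ : 1 ≤ C₀) (hC₁ : 1 ≤ C₁) (hC₀' : 1 ≤ C₀') (hC₁' : 1 ≤ C₁')
    (hDφ : ∀ (j : ℕ) (t : ℝ), ‖iteratedFDeriv ℝ j φ t‖ ≤ C₀ * C₁ ^ j * ((Nat.factorial j : ℕ) : ℝ) ^ s)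
    (hDψ : ∀ (i : ℕ) (t : ℝ), ‖iteratedFDeriv ℝ i stepψ t‖ ≤ C₀' * C₁' ^ i * ((Nat.factorial i : ℕ) : ℝ) ^ s) :
    ∃ α C : ℝ, ∃ γ : ℕ, 0 ≤ α ∧ 0 ≤ C ∧ ∀ n : ℕ, 1 ≤ n →
      ∀ (F : SchwartzMap (Fin n → EuclideanSpace ℝ (Fin 4)) ℂ), IsOffDiagonal F →
      ∀ (G : (Fin n → EuclideanSpace ℝ (Fin 4)) → ℝ), ContDiff ℝ ∞ G →
        (∀ (j : ℕ) (w : Fin n → EuclideanSpace ℝ (Fin 4)), ‖iteratedFDeriv ℝ j G w‖ ≤ ‖iteratedFDeriv ℝ j F w‖) →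
      ∀ k : ℕ, ∃ M : (Fin n × Fin 4 → ℤ) → ℝ, (∀ c, 0 ≤ M c) ∧ Summable M ∧
        ∑' c, M c ≤ α * C ^ n * (n.factorial : ℝ) ^ γ * (2 : ℝ)⁻¹ ^ k * schwartzNorm ((N' + 6 + K₀) * n) F ∧
        ∑' c, M c / (2 * ((2 : ℝ)⁻¹ ^ k / (8 * (Λ + 1)))) ^ (K₀ * n) ≤
          α * C ^ n * (n.factorial : ℝ) ^ γ * (2 : ℝ)⁻¹ ^ k * schwartzNorm ((N' + 6 + K₀) * n) F ∧
        ∀ (c : Fin n × Fin 4 → ℤ) (m : ℕ), m ≤ N' * n → ∀ z : Fin n → EuclideanSpace ℝ (Fin 4),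
          ‖iteratedFDeriv ℝ m (fun w => G w * (tele (fun j => pairCut n j w) k *
              gridBump φ n ((2 : ℝ)⁻¹ ^ k / (8 * (Λ + 1))) c w)) z‖ ≤
            M c / (2 * ((2 : ℝ)⁻¹ ^ k / (8 * (Λ + 1)))) ^ m := by
  have hΛ0 : 0 < Λ := by linarith
  have hC₀0 : 0 ≤ C₀ := by linarith
  have hC₁0 : 0 ≤ C₁ := by linarith
  have hC₀'0 : 0 ≤ C₀' := by linarith
  have hC₁'0 : 0 ≤ C₁' := by linarith
  have hL0 : 0 ≤ Λ + 1 := by linarith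
  have hL1 : 1 ≤ Λ + 1 := by linarith
  have hLpos : 0 < Λ + 1 := by linarith
  obtain ⟨α, C, γ, hα, hC, hT⟩ := adm_levelConst Λ N' s hC₀0 hC₁0 hC₀'0 hC₁'0 hL0
  -- the weighted constant `C' = C · (16(Λ+1))^{K₀}`
  refine ⟨α, C * (16 * (Λ + 1)) ^ K₀, γ, hα, by positivity, fun n hn F hF G hG hGF k => ?_⟩
  have hW16 : (1 : ℝ) ≤ (16 * (Λ + 1)) ^ (K₀ * n) := one_le_pow₀ (by nlinarith)
  have hCpow : (C * (16 * (Λ + 1)) ^ K₀) ^ n = C ^ n * (16 * (Λ + 1)) ^ (K₀ * n) := by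
    rw [mul_pow, ← pow_mul]
  -- `‖φ‖ ≤ 1` and the step thresholds (as in `level_weights`)
  have hφn : ∀ t : ℝ, ‖φ t‖ ≤ 1 := by
    intro t
    rw [Real.norm_eq_abs, abs_of_nonneg (hφ0 t)]
    by_cases hmem : (0 : ℤ) ∈ Finset.Icc (⌊t⌋ - 1) (⌈t⌉ + 1)
    · have hle : φ (t - ((0 : ℤ) : ℝ)) ≤ ∑ j ∈ Finset.Icc (⌊t⌋ - 1) (⌈t⌉ + 1), φ (t - j) :=
        Finset.single_le_sum (f := fun j : ℤ => φ (t - j)) (fun j _ => hφ0 _) hmem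
      rw [sum_Icc_profile_eq_one hφs hφ1 t, Int.cast_zero, sub_zero] at hle
      exact hle
    · have h0 := profile_sub_eq_zero hφs t hmem
      rw [Int.cast_zero, sub_zero] at h0
      rw [h0]; exact zero_le_one
  have hψ4 : ∀ x : ℝ, 4 ≤ x → stepψ x = 1 := fun x hx => stepψ_eq_one hx
  -- small facts about `n`, the Schwartz index and the polynomial `Q(n)`
  have hn0 : (0 : ℝ) ≤ n := Nat.cast_nonneg n
  have hQ1 : (1 : ℝ) ≤ (1 + 32 * C₀' * C₁' * (n : ℝ) ^ 2 + 64 * C₀ * C₁ * (Λ + 1) * n) := by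
    have h1 : 0 ≤ 32 * C₀' * C₁' * (n : ℝ) ^ 2 := by positivity
    have h2 : 0 ≤ 64 * C₀ * C₁ * (Λ + 1) * n := by positivity
    linarith
  have hKN : N' * n + 4 * n + 2 ≤ (N' + 6 + K₀) * n := by nlinarith
  have hKN' : N' * n + 4 * n + 2 + K₀ * n ≤ (N' + 6 + K₀) * n := by nlinarith
  have hSN : 0 ≤ schwartzNorm ((N' + 6 + K₀) * n) F := schwartzNorm_nonneg _ _
  have hfac0 : (0 : ℝ) ≤ (((N' * n).factorial : ℕ) : ℝ) ^ (s + 1) := by positivity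
  have hfar0 : (0 : ℝ) ≤ 2 ^ (4 * n + 1) * (24 * (Λ + 1)) ^ (4 * n) * ((((N' * n).factorial : ℕ) : ℝ) ^ (s + 1) * (2 ^ (N' * n + 4 * n + 2) * 2 ^ (4 * n + 2) * (1 + 32 * C₀' * C₁' * (n : ℝ) ^ 2 + 64 * C₀ * C₁ * (Λ + 1) * n) ^ (N' * n))) := by positivity
  have hband0 : (0 : ℝ) ≤ 2 * (2 ^ (4 * n) * ((n : ℝ) ^ 2 * (64 * (Λ + 1) + 11) ^ 4 * (48 * (Λ + 1)) ^ (4 * n)) * ((((N' * n).factorial : ℕ) : ℝ) ^ (s + 1) * (2 ^ (N' * n + 4 * n + 2) * 4 ^ (4 * n) * (1 + 32 * C₀' * C₁' * (n : ℝ) ^ 2 + 64 * C₀ * C₁ * (Λ + 1) * n) ^ (N' * n) * (1 + 32 * C₀' * C₁' * (n : ℝ) ^ 2 + 64 * C₀ * C₁ * (Λ + 1) * n) ^ (N' * n)))) := by positivity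
  have hTn := hT n hn
  have hfar_le : 2 ^ (4 * n + 1) * (24 * (Λ + 1)) ^ (4 * n) * ((((N' * n).factorial : ℕ) : ℝ) ^ (s + 1) * (2 ^ (N' * n + 4 * n + 2) * 2 ^ (4 * n + 2) * (1 + 32 * C₀' * C₁' * (n : ℝ) ^ 2 + 64 * C₀ * C₁ * (Λ + 1) * n) ^ (N' * n))) ≤ α * C ^ n * (n.factorial : ℝ) ^ γ := le_trans (le_add_of_nonneg_right hband0) hTn
  have hband_le : 2 * (2 ^ (4 * n) * ((n : ℝ) ^ 2 * (64 * (Λ + 1) + 11) ^ 4 * (48 * (Λ + 1)) ^ (4 * n)) * ((((N' * n).factorial : ℕ) : ℝ) ^ (s + 1) * (2 ^ (N' * n + 4 * n + 2) * 4 ^ (4 * n) * (1 + 32 * C₀' * C₁' * (n : ℝ) ^ 2 + 64 * C₀ * C₁ * (Λ + 1) * n) ^ (N' * n) * (1 + 32 * C₀' * C₁' * (n : ℝ) ^ 2 + 64 * C₀ * C₁ * (Λ + 1) * n) ^ (N' * n)))) ≤ α * C ^ n * (n.factorial : ℝ) ^ γ := le_trans (le_add_of_nonneg_left hfar0) hT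n
  clear hTn hT
  have hB0 : 0 ≤ α * C ^ n * (n.factorial : ℝ) ^ γ := le_trans hfar0 hfar_le
  -- the common final step: from an unweighted mass with a gain to both clauses (vi)
  have finish : ∀ (M : (Fin n × Fin 4 → ℤ) → ℝ) (ρ w : ℝ), (∀ c, 0 ≤ M c) → Summable M → 0 < ρ → ρ ≤ 1 / 2 →
      0 ≤ w → ρ ^ (K₀ * n) * (16 * (Λ + 1)) ^ (K₀ * n) = w →
      ∑' c, M c ≤ w * (α * C ^ n * (n.factorial : ℝ) ^ γ) * (2 : ℝ)⁻¹ ^ k * schwartzNorm ((N' + 6 + K₀) * n) F →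
      ∑' c, M c ≤ α * (C * (16 * (Λ + 1)) ^ K₀) ^ n * (n.factorial : ℝ) ^ γ * (2 : ℝ)⁻¹ ^ k *
          schwartzNorm ((N' + 6 + K₀) * n) F ∧
      ∑' c, M c / ρ ^ (K₀ * n) ≤ α * (C * (16 * (Λ + 1)) ^ K₀) ^ n * (n.factorial : ℝ) ^ γ * (2 : ℝ)⁻¹ ^ k *
          schwartzNorm ((N' + 6 + K₀) * n) F := by
    intro M ρ w hM0 hMs hρ hρ2 hw0 hw hsum
    have hρK : 0 < ρ ^ (K₀ * n) := pow_pos hρ _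
    have hρK1 : ρ ^ (K₀ * n) ≤ 1 := pow_le_one₀ hρ.le (by linarith)
    have hw1 : w ≤ (16 * (Λ + 1)) ^ (K₀ * n) := by
      rw [← hw]; exact mul_le_of_le_one_left (by positivity) hρK1
    have hrest : 0 ≤ (α * C ^ n * (n.factorial : ℝ) ^ γ) * (2 : ℝ)⁻¹ ^ k * schwartzNorm ((N' + 6 + K₀) * n) F := by
      positivity
    have htarget : (16 * (Λ + 1)) ^ (K₀ * n) * (α * C ^ n * (n.factorial : ℝ) ^ γ) * (2 : ℝ)⁻¹ ^ k *
        schwartzNorm ((N' + 6 + K₀) * n) F =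
        α * (C * (16 * (Λ + 1)) ^ K₀) ^ n * (n.factorial : ℝ) ^ γ * (2 : ℝ)⁻¹ ^ k * schwartzNorm ((N' + 6 + K₀) * n) F := by
      rw [hCpow]; ring
    constructor
    · calc ∑' c, M c ≤ w * (α * C ^ n * (n.factorial : ℝ) ^ γ) * (2 : ℝ)⁻¹ ^ k * schwartzNorm ((N' + 6 + K₀) * n) F := hsum
        _ = w * ((α * C ^ n * (n.factorial : ℝ) ^ γ) * (2 : ℝ)⁻¹ ^ k * schwartzNorm ((N' + 6 + K₀) * n) F) := by ring
        _ ≤ (16 * (Λ + 1)) ^ (K₀ * n) * ((α * C ^ n * (n.factorial : ℝ) ^ γ) * (2 : ℝ)⁻¹ ^ k *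
              schwartzNorm ((N' + 6 + K₀) * n) F) := mul_le_mul_of_nonneg_right hw1 hrest
        _ = _ := by rw [← htarget]; ring
    · rw [tsum_div_const, div_le_iff₀ hρK]
      calc ∑' c, M c ≤ w * (α * C ^ n * (n.factorial : ℝ) ^ γ) * (2 : ℝ)⁻¹ ^ k * schwartzNorm ((N' + 6 + K₀) * n) F := hsum
        _ = (16 * (Λ + 1)) ^ (K₀ * n) * (α * C ^ n * (n.factorial : ℝ) ^ γ) * (2 : ℝ)⁻¹ ^ k *
              schwartzNorm ((N' + 6 + K₀) * n) F * ρ ^ (K₀ * n) := by rw [← hw]; ring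
        _ = _ := by rw [htarget]
  cases k with
  | zero =>
    -- ### the far level (mesh `h₀ = 2⁰/(8(Λ+1))`, rate `R₀`): the E2 estimate verbatim, weight `(4(Λ+1))^{K₀ n} ≤ (16(Λ+1))^{K₀ n}`
    clear hband_le hband0
    have e3 := three_div_mesh hΛ 0
    have e4 := two_mesh_mul_farRate_le (C₀ := C₀) (C₁ := C₁) (C₀' := C₀') (C₁' := C₁') hΛ hC₀0 hC₁0 hC₀'0 hC₁'0 n
    have hh0 := mesh_pos hΛ 0
    have hh2 := two_mesh_le_half hΛ 0
    have hRpos := farRate_pos (C₀ := C₀) (C₁ := C₁) (C₀' := C₀') (C₁' := C₁') hΛ hC₀ hC₁ hC₀' hC₁' hn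
    have hA : (0 : ℝ) ≤ 2 ^ (4 * n + 1) := by positivity
    have hp : (0 : ℝ) ≤ 3 / ((2 : ℝ)⁻¹ ^ 0 / (8 * (Λ + 1))) := div_nonneg zero_le_three hh0.le
    have hpp : (3 : ℝ) / ((2 : ℝ)⁻¹ ^ 0 / (8 * (Λ + 1))) ≤ 24 * (Λ + 1) := by rw [e3, pow_zero, mul_one]
    have hmaxK : max (4 * n + 2) (N' * n) ≤ N' * n + 4 * n + 2 := by omega
    have ht : (0 : ℝ) ≤ 2 ^ max (4 * n + 2) (N' * n) := by positivity
    have htt : (2 : ℝ) ^ max (4 * n + 2) (N' * n) ≤ 2 ^ (N' * n + 4 * n + 2) := pow_le_pow_right₀ (by norm_num) hmaxK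
    have hu : (0 : ℝ) ≤ 2 ^ (4 * n + 2) := by positivity
    have hS : 0 ≤ schwartzNorm (max (4 * n + 2) (N' * n)) F := schwartzNorm_nonneg _ _
    have hSS : schwartzNorm (max (4 * n + 2) (N' * n)) F ≤ schwartzNorm (N' * n + 4 * n + 2) F := schwartzNorm_mono hmaxK F
    have hS₁ : schwartzNorm (N' * n + 4 * n + 2) F ≤ schwartzNorm ((N' + 6 + K₀) * n) F := schwartzNorm_mono hKN F
    have hm : 0 ≤ max 1 (2 * ((2 : ℝ)⁻¹ ^ 0 / (8 * (Λ + 1))) * (1 + ((n : ℝ) ^ 2 * (8 * C₀' * C₁') + 4 * n * (C₀ * C₁ / ((2 : ℝ)⁻¹ ^ 0 / (8 * (Λ + 1))))))) := le_trans zero_le_one (le_max_left _ _)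
    have hmq : max 1 (2 * ((2 : ℝ)⁻¹ ^ 0 / (8 * (Λ + 1))) * (1 + ((n : ℝ) ^ 2 * (8 * C₀' * C₁') + 4 * n * (C₀ * C₁ / ((2 : ℝ)⁻¹ ^ 0 / (8 * (Λ + 1))))))) ≤ (1 + 32 * C₀' * C₁' * (n : ℝ) ^ 2 + 64 * C₀ * C₁ * (Λ + 1) * n) := by
      refine max_le hQ1 (e4.trans ?_)
      exact le_rfl
    have hr : (2 : ℝ)⁻¹ ^ 0 = 1 := pow_zero _
    have hb : ∀ (c : Fin n × Fin 4 → ℤ) (z : Fin n → EuclideanSpace ℝ (Fin 4)) (i : ℕ), i ≤ N' * n →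
        ‖iteratedFDeriv ℝ i (fun w => pairCut n 0 w * gridBump φ n ((2 : ℝ)⁻¹ ^ 0 / (8 * (Λ + 1))) c w) z‖ ≤
          ((Nat.factorial i : ℕ) : ℝ) ^ (s + 1) * ((n : ℝ) ^ 2 * (8 * C₀' * C₁') + 4 * n * (C₀ * C₁ / ((2 : ℝ)⁻¹ ^ 0 / (8 * (Λ + 1))))) ^ i := by
      intro c z i _
      have := norm_iteratedFDeriv_farBump_le_gevrey hφ hφn contDiff_stepψ hψ4 stepψ_nonneg stepψ_le_one hC₀ hC₁0 hC₀' hC₁'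
        hDφ hDψ hh0 c i z
      rw [cut_stepψ] at this
      exact this
    obtain ⟨M, hM0, hMs, hMle, hMv⟩ := far_level_mass_factorial F hG hGF hφ hφs hh0 hh2 (N' * n) (s + 1) hRpos hb
    have hsum := hMle.trans (far_skeleton hA hp hpp hfac0 ht htt hu hS hSS hS₁ hm hmq hfar_le hr)
    -- the weight of the far level
    have hw : (2 * ((2 : ℝ)⁻¹ ^ 0 / (8 * (Λ + 1)))) ^ (K₀ * n) * (16 * (Λ + 1)) ^ (K₀ * n) = (4 : ℝ) ^ (K₀ * n) := by
      rw [← mul_pow]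
      congr 1
      have := two_mesh_zero_mul hΛ
      linear_combination (4 : ℝ) * this
    have h4 : (1 : ℝ) ≤ (4 : ℝ) ^ (K₀ * n) := one_le_pow₀ (by norm_num)
    have hsum' : ∑' c, M c ≤ (4 : ℝ) ^ (K₀ * n) * (α * C ^ n * (n.factorial : ℝ) ^ γ) * (2 : ℝ)⁻¹ ^ 0 *
        schwartzNorm ((N' + 6 + K₀) * n) F := by
      have hrest : 0 ≤ (α * C ^ n * (n.factorial : ℝ) ^ γ) * (2 : ℝ)⁻¹ ^ 0 * schwartzNorm ((N' + 6 + K₀) * n) F := by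
        positivity
      calc ∑' c, M c ≤ _ := hsum
        _ = 1 * ((α * C ^ n * (n.factorial : ℝ) ^ γ) * (2 : ℝ)⁻¹ ^ 0 * schwartzNorm ((N' + 6 + K₀) * n) F) := by ring
        _ ≤ (4 : ℝ) ^ (K₀ * n) * ((α * C ^ n * (n.factorial : ℝ) ^ γ) * (2 : ℝ)⁻¹ ^ 0 * schwartzNorm ((N' + 6 + K₀) * n) F) :=
            mul_le_mul_of_nonneg_right h4 hrest
        _ = _ := by ring
    have hw0 : (0 : ℝ) ≤ (4 : ℝ) ^ (K₀ * n) := by positivity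
    obtain ⟨h6, h6w⟩ := finish M (2 * ((2 : ℝ)⁻¹ ^ 0 / (8 * (Λ + 1)))) ((4 : ℝ) ^ (K₀ * n)) hM0 hMs (mul_pos two_pos hh0) hh2
      hw0 hw hsum'
    refine ⟨M, hM0, hMs, h6, h6w, ?_⟩
    intro c m' hm' z
    simp only [tele_pairCut_zero]
    exact hMv c m' hm' z
  | succ k =>
    -- ### the band level `k+1` (mesh `h_{k+1}`, rate `R_{k+1}`), flatness order `K = N'n + 4n + 2 + K₀ n`
    clear hfar_le hfar0
    have hh0 := mesh_pos hΛ (k + 1)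
    have hh2 := two_mesh_le_half hΛ (k + 1)
    -- the weight of the band level: `ρ_{k+1}^{K₀n} (16(Λ+1))^{K₀n} = 2^{K₀n} (2^{-k})^{K₀n}`
    have hw : (2 * ((2 : ℝ)⁻¹ ^ (k + 1) / (8 * (Λ + 1)))) ^ (K₀ * n) * (16 * (Λ + 1)) ^ (K₀ * n) =
        (2 : ℝ) ^ (K₀ * n) * ((2 : ℝ)⁻¹ ^ k) ^ (K₀ * n) := by
      rw [← mul_pow, ← mul_pow]
      congr 1
      have := two_mesh_succ_mul hΛ k
      linear_combination (2 : ℝ) * this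
    by_cases hn2 : n < 2
    · -- `n = 1`: no pairs, every band piece vanishes
      have hbound0 : 0 ≤ α * (C * (16 * (Λ + 1)) ^ K₀) ^ n * (n.factorial : ℝ) ^ γ * (2 : ℝ)⁻¹ ^ (k + 1) *
          schwartzNorm ((N' + 6 + K₀) * n) F := by positivity
      refine ⟨fun _ => 0, fun _ => le_rfl, summable_zero, by rw [tsum_zero]; exact hbound0, ?_, fun c m _ z => ?_⟩
      · simp only [zero_div, tsum_zero]; exact hbound0
      have hzero : (fun w => G w * (tele (fun j => pairCut n j w) (k + 1) *
          gridBump φ n ((2 : ℝ)⁻¹ ^ (k + 1) / (8 * (Λ + 1))) c w)) = fun _ => (0 : ℝ) := by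
        funext w; rw [tele_pairCut_succ, bandPiece_eq_zero_of_lt_two hn2, mul_zero]
      rw [hzero, iteratedFDeriv_fun_zero, Pi.zero_apply, norm_zero, zero_div]
    push Not at hn2
    have e1 := inv_pow_mul_bandRate (C₀ := C₀) (C₁ := C₁) (C₀' := C₀') (C₁' := C₁') hΛ n k
    have e2 := two_mesh_mul_bandRate_le (C₀ := C₀) (C₁ := C₁) (C₀' := C₀') (C₁' := C₁') hΛ hC₀0 hC₁0 hC₀'0 hC₁'0 n k
    have e3 := three_div_mesh hΛ (k + 1)
    have hRge := pow_le_bandRate (C₀ := C₀) (C₁ := C₁) (C₀' := C₀') (C₁' := C₁') hΛ hC₀ hC₁ hC₀' hC₁' hn k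
    have hNK : N' * n < N' * n + 4 * n + 2 + K₀ * n := by omega
    -- the ingredients of the band skeleton
    have ha : (0 : ℝ) ≤ 2 ^ (4 * n - 4 + 1) := by positivity
    have haa : (2 : ℝ) ^ (4 * n - 4 + 1) ≤ 2 ^ (4 * n) := pow_le_pow_right₀ (by norm_num) (by omega)
    have hn₂ : (0 : ℝ) ≤ (n : ℝ) ^ 2 := by positivity
    have hc : (0 : ℝ) ≤ 2 * (⌈(2 * (2 : ℝ)⁻¹ ^ k + 4 * ((2 : ℝ)⁻¹ ^ (k + 1) / (8 * (Λ + 1)))) / ((2 : ℝ)⁻¹ ^ (k + 1) / (8 * (Λ + 1)))⌉₊ : ℝ) + 1 := by positivity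
    have hcc := ceil_ratio_le hΛ k
    have hp : (0 : ℝ) ≤ 3 / ((2 : ℝ)⁻¹ ^ (k + 1) / (8 * (Λ + 1))) := div_nonneg zero_le_three hh0.le
    have hpe : ((3 : ℝ) / ((2 : ℝ)⁻¹ ^ (k + 1) / (8 * (Λ + 1)))) ^ (4 * n - 4) ≤ (48 * (Λ + 1)) ^ (4 * n) * ((2 : ℝ) ^ k) ^ (4 * n - 4) := by
      have h3 : (3 : ℝ) / ((2 : ℝ)⁻¹ ^ (k + 1) / (8 * (Λ + 1))) = 48 * (Λ + 1) * 2 ^ k := by rw [e3, pow_succ]; ring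
      rw [h3, mul_pow]
      exact mul_le_mul_of_nonneg_right
        (pow_le_pow_right₀ (hL1.trans (le_mul_of_one_le_left hL0 (by norm_num))) (by omega)) (by positivity)
    have hP : (0 : ℝ) ≤ (48 * (Λ + 1)) ^ (4 * n) := by positivity
    have hG' : (0 : ℝ) ≤ ((2 : ℝ) ^ k) ^ (4 * n - 4) := by positivity
    have htk : (0 : ℝ) ≤ 2 ^ max (4 * n - 4 + 2) (N' * n + 4 * n + 2 + K₀ * n) := by positivity
    have htt : (2 : ℝ) ^ max (4 * n - 4 + 2) (N' * n + 4 * n + 2 + K₀ * n) ≤ 2 ^ (N' * n + 4 * n + 2) * 2 ^ (K₀ * n) := by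
      rw [← pow_add]
      exact pow_le_pow_right₀ (by norm_num) (max_le (by omega) le_rfl)
    have hf : (0 : ℝ) ≤ 4 ^ (4 * n - 4 + 2) := by positivity
    have hff : (4 : ℝ) ^ (4 * n - 4 + 2) ≤ 4 ^ (4 * n) := pow_le_pow_right₀ (by norm_num) (by omega)
    have hS : 0 ≤ schwartzNorm (max (4 * n - 4 + 2) (N' * n + 4 * n + 2 + K₀ * n)) F := schwartzNorm_nonneg _ _
    have hSS : schwartzNorm (max (4 * n - 4 + 2) (N' * n + 4 * n + 2 + K₀ * n)) F ≤ schwartzNorm ((N' + 6 + K₀) * n) F :=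
      schwartzNorm_mono ((max_le (by omega) le_rfl).trans hKN') F
    have hq₀ : (0 : ℝ) ≤ 1 + (2 : ℝ)⁻¹ ^ k * (2 * ((n : ℝ) ^ 2 * (8 * C₀' * C₁' * (2 : ℝ) ^ (k + 1))) + 4 * n * (C₀ * C₁ / ((2 : ℝ)⁻¹ ^ (k + 1) / (8 * (Λ + 1))))) := by rw [e1]; positivity
    have hqQ : 1 + (2 : ℝ)⁻¹ ^ k * (2 * ((n : ℝ) ^ 2 * (8 * C₀' * C₁' * (2 : ℝ) ^ (k + 1))) + 4 * n * (C₀ * C₁ / ((2 : ℝ)⁻¹ ^ (k + 1) / (8 * (Λ + 1))))) ≤ (1 + 32 * C₀' * C₁' * (n : ℝ) ^ 2 + 64 * C₀ * C₁ * (Λ + 1) * n) := by rw [e1, ← add_assoc]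
    have hg : (0 : ℝ) ≤ ((2 : ℝ)⁻¹ ^ k) ^ (N' * n + 4 * n + 2 + K₀ * n) := by positivity
    have hm : 0 ≤ max 1 (2 * ((2 : ℝ)⁻¹ ^ (k + 1) / (8 * (Λ + 1))) * (2 * ((n : ℝ) ^ 2 * (8 * C₀' * C₁' * (2 : ℝ) ^ (k + 1))) + 4 * n * (C₀ * C₁ / ((2 : ℝ)⁻¹ ^ (k + 1) / (8 * (Λ + 1)))))) := le_trans zero_le_one (le_max_left _ _)
    have hmQ : max 1 (2 * ((2 : ℝ)⁻¹ ^ (k + 1) / (8 * (Λ + 1))) * (2 * ((n : ℝ) ^ 2 * (8 * C₀' * C₁' * (2 : ℝ) ^ (k + 1))) + 4 * n * (C₀ * C₁ / ((2 : ℝ)⁻¹ ^ (k + 1) / (8 * (Λ + 1)))))) ≤ (1 + 32 * C₀' * C₁' * (n : ℝ) ^ 2 + 64 * C₀ * C₁ * (Λ + 1) * n) := by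
      refine max_le hQ1 (e2.trans ?_)
      rw [add_assoc]
      exact le_add_of_nonneg_left zero_le_one
    -- the sharpened dyadic gain: `(2^k)^{4n-4} (2^{-k})^{K} ≤ 2^{-k} (2^{-k})^{K₀ n}`
    have hgain : ((2 : ℝ) ^ k) ^ (4 * n - 4) * ((2 : ℝ)⁻¹ ^ k) ^ (N' * n + 4 * n + 2 + K₀ * n) ≤
        (2 : ℝ)⁻¹ ^ k * ((2 : ℝ)⁻¹ ^ k) ^ (K₀ * n) := by
      rw [pow_add, ← mul_assoc]
      exact mul_le_mul_of_nonneg_right (dyadic_gain_le (by omega) k) (by positivity)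
    have hr : (2 : ℝ)⁻¹ ^ k * ((2 : ℝ)⁻¹ ^ k) ^ (K₀ * n) = 2 * ((2 : ℝ)⁻¹ ^ (k + 1) * ((2 : ℝ)⁻¹ ^ k) ^ (K₀ * n)) := by
      rw [pow_succ]; ring
    -- the admissible constant with the extra factor `2^{K₀ n}`
    have hB : 2 * (2 ^ (4 * n) * ((n : ℝ) ^ 2 * (64 * (Λ + 1) + 11) ^ 4 * (48 * (Λ + 1)) ^ (4 * n)) *
        ((((N' * n).factorial : ℕ) : ℝ) ^ (s + 1) * ((2 ^ (N' * n + 4 * n + 2) * 2 ^ (K₀ * n)) * 4 ^ (4 * n) *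
          (1 + 32 * C₀' * C₁' * (n : ℝ) ^ 2 + 64 * C₀ * C₁ * (Λ + 1) * n) ^ (N' * n) *
          (1 + 32 * C₀' * C₁' * (n : ℝ) ^ 2 + 64 * C₀ * C₁ * (Λ + 1) * n) ^ (N' * n)))) ≤
        2 ^ (K₀ * n) * (α * C ^ n * (n.factorial : ℝ) ^ γ) := by
      have h2K : (0 : ℝ) ≤ 2 ^ (K₀ * n) := by positivity
      have := mul_le_mul_of_nonneg_left hband_le h2K
      refine le_trans (le_of_eq ?_) this
      ring
    -- the rates of the band bumps and the band level mass at the sharper flatness order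
    have hb : ∀ (c : Fin n × Fin 4 → ℤ) (z : Fin n → EuclideanSpace ℝ (Fin 4)) (i : ℕ), i ≤ N' * n →
        ‖iteratedFDeriv ℝ i (fun w => (pairCut n (k + 1) w - pairCut n k w) * gridBump φ n ((2 : ℝ)⁻¹ ^ (k + 1) / (8 * (Λ + 1))) c w) z‖ ≤
          ((Nat.factorial i : ℕ) : ℝ) ^ (s + 1) * (2 * ((n : ℝ) ^ 2 * (8 * C₀' * C₁' * (2 : ℝ) ^ (k + 1))) + 4 * n * (C₀ * C₁ / ((2 : ℝ)⁻¹ ^ (k + 1) / (8 * (Λ + 1))))) ^ i := by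
      intro c z i _
      have := norm_iteratedFDeriv_bandBump_le_gevrey hφ hφn contDiff_stepψ hψ4 stepψ_nonneg stepψ_le_one hC₀ hC₁0 hC₀' hC₁'
        hDφ hDψ hn hh0 k c i z
      rw [cut_stepψ, cut_stepψ] at this
      exact this
    obtain ⟨M, hM0, hMs, hMle, hMv⟩ :=
      level_mass_factorial hn2 F hF hG hGF hφ hφs hh0 hh2 k (K := N' * n + 4 * n + 2 + K₀ * n) hNK (s + 1) hRge hb
    have hsum := hMle.trans (band_skeleton ha haa hn₂ hc hcc hp hpe hP hG' hfac0 htk htt hf hff hS hSS hq₀ hqQ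
      hg hm hmQ hgain hr hB)
    have hsum' : ∑' c, M c ≤ (2 : ℝ) ^ (K₀ * n) * ((2 : ℝ)⁻¹ ^ k) ^ (K₀ * n) * (α * C ^ n * (n.factorial : ℝ) ^ γ) *
        (2 : ℝ)⁻¹ ^ (k + 1) * schwartzNorm ((N' + 6 + K₀) * n) F := by
      refine hsum.trans (le_of_eq ?_); ring
    have hw0 : (0 : ℝ) ≤ (2 : ℝ) ^ (K₀ * n) * ((2 : ℝ)⁻¹ ^ k) ^ (K₀ * n) := by positivity
    obtain ⟨h6, h6w⟩ := finish M (2 * ((2 : ℝ)⁻¹ ^ (k + 1) / (8 * (Λ + 1)))) ((2 : ℝ) ^ (K₀ * n) * ((2 : ℝ)⁻¹ ^ k) ^ (K₀ * n))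
      hM0 hMs (mul_pos two_pos hh0) hh2 hw0 hw hsum'
    refine ⟨M, hM0, hMs, h6, h6w, ?_⟩
    intro c m' hm' z
    simp only [tele_pairCut_succ]
    exact hMv c m' hm' z

end Summit.QuantumFields.YangMills.Cruxes.HypercubicOSDataFromInfiniteVolume.WeightedWhitney

end
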